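import Summits.Ventures.PackingBounds.SphericalCodes.ThreePointEqualityCase
import Literature.Geometry.DiscreteGeometry.ThreePointKernelGeneral

/-!
# `A(9, arccos 1/3) ≤ 98` from an exact value-`99` three-point certificate (abstract form)

Venture PackingBounds, cell `pub-packcert` (sdp unit).  Bachoc–Vallentin's three-point bound for
spherical codes in `S⁸` with minimal angular distance `arccos 1/3` has (numerically, and — by the
exact certificate `sdp-n9-d10-s1-3-sym-exact99*.json` of the cell — exactly) the optimal value
`99`.  This file proves the *counting step* that turns an exact value-`99` certificate into the
bound `98`: if the two-point part `A = Σ_k a_k C_k^{7/2}` of a Bachoc–Vallentin certificate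
(with `B = 0`) has `a_1, …, a_4 > 0`, the certificate's value `1 + A(1) + F(1,1,1)` is exactly
`99`, and the slack of constraint (i), `-1 - A(u) - 3F(u,u,1)`, vanishes on `[-1, 1/3]` only at
`u ∈ {-1, -1/3, 0, 1/3}`, then every `arccos(1/3)`-code in `S⁸` has at most `98` points.

Proof: a `99`-point code would attain the bound, so by the equality case
(`threePoint_tight_of_card_eq`) `Σ_{x,y} A(x·y) = 0` and constraint (i) is tight at every pair
of distinct code points; hence all inner products of distinct points lie in
`{-1, -1/3, 0, 1/3}` and `Σ_{x,y} C_k^{7/2}(x·y) = 0` for `k = 1, …, 4`.  Writing `n_t` for the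
number of ordered pairs at inner product `t`, these are four linear equations whose unique
solution has `n_{1/3} = 8019/2 ∉ ℕ` — a contradiction.

Framing (cell rule): lottery ticket; floor = certified bounds/negative ranges.  This is the
formal core of step R5 of the referee protocol for the candidate row
`A(9, arccos 1/3) ≤ 98`; instantiating the hypotheses with the explicit certificate is a
separate (computational) step.
-/

noncomputable section

open Finset
open scoped RealInnerProductSpace

namespace Summit.Ventures.PackingBounds.SphericalCodes

open Literature.Geometry.DiscreteGeometry.BachocVallentin Literature.Analysis.SpecialFunctions

/-! ### The Gegenbauer polynomials `C_k^{7/2}`, `k = 1, …, 4` -/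

/-- `C_1^{7/2}(s) = 7s`. -/
theorem gegenbauerSum_sevenHalves_one (s : ℝ) : gegenbauerSum (7 / 2) 1 s = 7 * s := by
  rw [gegenbauerSum_one]; ring

/-- `C_2^{7/2}(s) = (63/2) s² - 7/2`. -/
theorem gegenbauerSum_sevenHalves_two (s : ℝ) :
    gegenbauerSum (7 / 2) 2 s = 63 / 2 * s ^ 2 - 7 / 2 := by
  simp only [gegenbauerSum, gegenbauerCoeff]
  norm_num [Finset.sum_range_succ, Finset.prod_range_succ, Nat.factorial]
  ring

/-- `C_3^{7/2}(s) = (231/2) s³ - (63/2) s`. -/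
theorem gegenbauerSum_sevenHalves_three (s : ℝ) :
    gegenbauerSum (7 / 2) 3 s = 231 / 2 * s ^ 3 - 63 / 2 * s := by
  simp only [gegenbauerSum, gegenbauerCoeff]
  norm_num [Finset.sum_range_succ, Finset.prod_range_succ, Nat.factorial]
  ring

/-- `C_4^{7/2}(s) = (3003/8) s⁴ - (693/4) s² + 63/8`. -/
theorem gegenbauerSum_sevenHalves_four (s : ℝ) :
    gegenbauerSum (7 / 2) 4 s = 3003 / 8 * s ^ 4 - 693 / 4 * s ^ 2 + 63 / 8 := by
  simp only [gegenbauerSum, gegenbauerCoeff]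
  norm_num [Finset.sum_range_succ, Finset.prod_range_succ, Nat.factorial]
  ring

variable {n : ℕ}

/-! ### Splitting the pair sum by the value of the inner product -/

/-- `Σ_{x,y∈C} P(x·y) = |C|·P(1) + Σ_{x ≠ y} P(x·y)` for unit vectors. -/
private theorem pairSum_split (C : Finset (EuclideanSpace ℝ (Fin n))) (P : ℝ → ℝ)
    (hself : ∀ x ∈ C, inner ℝ x x = (1 : ℝ)) :
    pairSum C P = (C.card : ℝ) * P 1 + ∑ x ∈ C, ∑ y ∈ C.erase x, P (inner ℝ x y) := by
  classical
  unfold pairSum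
  have h : ∀ x ∈ C, ∑ y ∈ C, P (inner ℝ x y) = P 1 + ∑ y ∈ C.erase x, P (inner ℝ x y) := by
    intro x hx
    rw [← Finset.add_sum_erase C (fun y => P (inner ℝ x y)) hx, hself x hx]
  rw [Finset.sum_congr rfl h, Finset.sum_add_distrib, Finset.sum_const, nsmul_eq_mul]

/-- If all inner products of distinct points of `C` lie in a finite set `T`, then
`Σ_{x ≠ y} P(x·y) = Σ_{t ∈ T} N_t · P(t)` with `N_t` the number of ordered pairs at inner
product `t`. -/
private theorem offdiag_sum_eq (C : Finset (EuclideanSpace ℝ (Fin n))) (P : ℝ → ℝ)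
    (T : Finset ℝ) (hT : ∀ x ∈ C, ∀ y ∈ C, x ≠ y → inner ℝ x y ∈ T) :
    ∑ x ∈ C, ∑ y ∈ C.erase x, P (inner ℝ x y) =
      ∑ t ∈ T, (((∑ x ∈ C, ((C.erase x).filter (fun y => inner ℝ x y = t)).card : ℕ) : ℝ) * P t) := by
  classical
  have hx : ∀ x ∈ C, ∑ y ∈ C.erase x, P (inner ℝ x y) =
      ∑ t ∈ T, ((((C.erase x).filter (fun y => inner ℝ x y = t)).card : ℕ) : ℝ) * P t := by
    intro x hx
    have hmaps : ∀ y ∈ C.erase x, inner ℝ x y ∈ T := fun y hy =>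
      hT x hx y (Finset.mem_of_mem_erase hy) (Finset.ne_of_mem_erase hy).symm
    rw [← Finset.sum_fiberwise_of_maps_to hmaps]
    refine Finset.sum_congr rfl fun t _ => ?_
    rw [Finset.sum_congr rfl fun y hy => by rw [(Finset.mem_filter.1 hy).2], Finset.sum_const,
      nsmul_eq_mul]
  rw [Finset.sum_congr rfl hx, Finset.sum_comm]
  refine Finset.sum_congr rfl fun t _ => ?_
  rw [← Finset.sum_mul, Nat.cast_sum]

/-! ### The counting theorem -/

/-- **`A(9, arccos 1/3) ≤ 98` from an exact value-`99` certificate.**  Let `C ⊂ S⁸` be a finite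
set of unit vectors with pairwise inner products `≤ 1/3`.  Suppose `A = Σ_{k ≤ deg} a_k C_k^{7/2}`
with all `a_k ≥ 0` and `a_1, a_2, a_3, a_4 > 0`, and `F` is a symmetric three-point function with
`Σ_{x,y,z ∈ C} F ≥ 0`, satisfying the Bachoc–Vallentin constraints (i) `A(u) + 3F(u,u,1) ≤ -1` on
`[-1, 1/3]` and (ii) `F ≤ 0` on the Gram-feasible part of `[-1,1/3]³` (the case `B = 0`), with
value exactly `1 + A(1) + F(1,1,1) = 99`, and such that (i) is tight on `[-1, 1/3]` only at
`u ∈ {1/3, 0, -1/3, -1}`.  Then `|C| ≤ 98`. -/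
theorem card_le_98_of_exact99_certificate (C : Finset (EuclideanSpace ℝ (Fin 9)))
    (hC : ∀ x ∈ C, ‖x‖ = 1) (hcode : ∀ x ∈ C, ∀ y ∈ C, x ≠ y → inner ℝ x y ≤ 1 / 3)
    (deg : ℕ) (hdeg : 4 ≤ deg) (a : ℕ → ℝ) (ha : ∀ k, 0 ≤ a k)
    (ha1 : 0 < a 1) (ha2 : 0 < a 2) (ha3 : 0 < a 3) (ha4 : 0 < a 4)
    (A : ℝ → ℝ) (hA : ∀ t, A t = ∑ k ∈ range (deg + 1), a k * gegenbauerSum (7 / 2) k t)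
    (F : ℝ → ℝ → ℝ → ℝ) (hF : 0 ≤ tripleSum C F)
    (hF12 : ∀ u v t, F u v t = F v u t) (hF23 : ∀ u v t, F u v t = F u t v)
    (h1 : ∀ u : ℝ, -1 ≤ u → u ≤ 1 / 3 → A u + 3 * F u u 1 ≤ -1)
    (h2 : ∀ u v t : ℝ, -1 ≤ u → u ≤ 1 / 3 → -1 ≤ v → v ≤ 1 / 3 → -1 ≤ t → t ≤ 1 / 3 →
      0 ≤ 1 + 2 * u * v * t - u ^ 2 - v ^ 2 - t ^ 2 → F u v t ≤ 0)
    (hval : 1 + A 1 + F 1 1 1 = 99)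
    (hzero : ∀ u : ℝ, -1 ≤ u → u ≤ 1 / 3 → A u + 3 * F u u 1 = -1 →
      u = 1 / 3 ∨ u = 0 ∨ u = -1 / 3 ∨ u = -1) :
    C.card ≤ 98 := by
  classical
  have h9 : (3 : ℕ) ≤ 9 := by norm_num
  have hμ : (((9 : ℕ) : ℝ) - 2) / 2 = 7 / 2 := by norm_num
  -- two-point positivity of each Gegenbauer term and of `A`
  have hPk : ∀ k, 0 ≤ pairSum C (fun t => gegenbauerSum (7 / 2) k t) := fun k => by
    have := pairSum_gegenbauer_nonneg h9 k C hC
    rwa [hμ] at this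
  have hAsum : pairSum C A = ∑ k ∈ range (deg + 1), a k * pairSum C (fun t => gegenbauerSum (7 / 2) k t) := by
    simp only [pairSum, hA, Finset.mul_sum]
    calc ∑ x ∈ C, ∑ y ∈ C, ∑ k ∈ range (deg + 1), a k * gegenbauerSum (7 / 2) k (inner ℝ x y)
        = ∑ x ∈ C, ∑ k ∈ range (deg + 1), ∑ y ∈ C, a k * gegenbauerSum (7 / 2) k (inner ℝ x y) :=
          Finset.sum_congr rfl fun x _ => Finset.sum_comm
      _ = ∑ k ∈ range (deg + 1), ∑ x ∈ C, ∑ y ∈ C, a k * gegenbauerSum (7 / 2) k (inner ℝ x y) :=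
          Finset.sum_comm
  have hApos : 0 ≤ pairSum C A := by
    rw [hAsum]; exact Finset.sum_nonneg fun k _ => mul_nonneg (ha k) (hPk k)
  -- the bound `|C| ≤ 99`
  have hle : (C.card : ℝ) ≤ 1 + A 1 + 0 + F 1 1 1 := by
    refine card_le_of_threePoint (1 / 3) C hC hcode A F 0 0 0 hApos hF hF12 hF23
      (fun l => by norm_num) (fun u hu hu' => by simpa using h1 u hu hu') ?_ (by linarith)
    intro u v t hu hu' hv hv' ht ht' hg
    simpa using h2 u v t hu hu' hv hv' ht ht' hg
  have hle99 : C.card ≤ 99 := by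
    have : (C.card : ℝ) ≤ 99 := by linarith
    exact_mod_cast this
  -- so it suffices to exclude `|C| = 99`
  by_contra hgt
  have hcard : C.card = 99 := by omega
  have heq : (C.card : ℝ) = 1 + A 1 + F 1 1 1 := by rw [hcard, hval]; norm_num
  obtain ⟨hA0, -, htight⟩ :=
    threePoint_tight_of_card_eq (1 / 3) C hC hcode A F hApos hF hF12 hF23 h1 h2 heq
  -- all inner products of distinct points lie in `T = {1/3, 0, -1/3, -1}`
  have hself : ∀ x ∈ C, inner ℝ x x = (1 : ℝ) := fun x hx => by
    rw [real_inner_self_eq_norm_sq, hC x hx]; norm_num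
  set T : Finset ℝ := {1 / 3, 0, -1 / 3, -1} with hTdef
  have hT : ∀ x ∈ C, ∀ y ∈ C, x ≠ y → inner ℝ x y ∈ T := by
    intro x hx y hy hxy
    have hlo : -1 ≤ inner ℝ x y := by
      have h := abs_real_inner_le_norm x y
      rw [hC x hx, hC y hy, mul_one] at h
      exact (abs_le.1 h).1
    have hz := hzero _ hlo (hcode x hx y hy hxy) (htight x hx y hy hxy)
    simp only [hTdef, Finset.mem_insert, Finset.mem_singleton]
    tauto
  -- each `Σ_{x,y} C_k^{7/2}(x·y)` vanishes for `k = 1, …, 4`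
  have hterm0 : ∀ k ∈ range (deg + 1), a k * pairSum C (fun t => gegenbauerSum (7 / 2) k t) = 0 := by
    have hs : ∑ k ∈ range (deg + 1), a k * pairSum C (fun t => gegenbauerSum (7 / 2) k t) = 0 := by
      rw [← hAsum]; exact hA0
    exact (Finset.sum_eq_zero_iff_of_nonneg fun k _ => mul_nonneg (ha k) (hPk k)).1 hs
  have hPk0 : ∀ k, k ≤ 4 → 0 < a k → pairSum C (fun t => gegenbauerSum (7 / 2) k t) = 0 := by
    intro k hk hak
    have hmem : k ∈ range (deg + 1) := Finset.mem_range.2 (by omega)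
    have := hterm0 k hmem
    rcases mul_eq_zero.1 this with h | h
    · exact absurd h hak.ne'
    · exact h
  -- the pair counts
  set N : ℝ → ℕ := fun t => ∑ x ∈ C, ((C.erase x).filter (fun y => inner ℝ x y = t)).card with hNdef
  have hexp : ∀ P : ℝ → ℝ, pairSum C P =
      99 * P 1 + ((N (1 / 3) : ℝ) * P (1 / 3) + ((N 0 : ℝ) * P 0 +
        ((N (-1 / 3) : ℝ) * P (-1 / 3) + (N (-1) : ℝ) * P (-1)))) := by
    intro P
    rw [pairSum_split C P hself, offdiag_sum_eq C P T hT, hcard, hTdef,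
      Finset.sum_insert (by norm_num), Finset.sum_insert (by norm_num),
      Finset.sum_insert (by norm_num), Finset.sum_singleton]
    norm_num [hNdef]
  have e1 := hPk0 1 (by norm_num) ha1
  have e2 := hPk0 2 (by norm_num) ha2
  have e3 := hPk0 3 (by norm_num) ha3
  have e4 := hPk0 4 (by norm_num) ha4
  rw [hexp] at e1 e2 e3 e4
  simp only [gegenbauerSum_sevenHalves_one, gegenbauerSum_sevenHalves_two,
    gegenbauerSum_sevenHalves_three, gegenbauerSum_sevenHalves_four] at e1 e2 e3 e4
  norm_num at e1 e2 e3 e4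
  -- the unique solution has `N_{1/3} = 8019/2`, impossible for a natural number
  have hN : (2 : ℝ) * (N (1 / 3) : ℝ) = 8019 := by
    linear_combination (-54 / 77) * e1 + (-243 / 728) * e2 + (-261 / 616) * e3 + (-27 / 182) * e4
  have hN' : 2 * N (1 / 3) = 8019 := by exact_mod_cast hN
  omega

/-- **Data form.**  The same conclusion for a certificate given by its data: `A = Σ_{k ≤ deg}
a_k C_k^{7/2}` (`a_k ≥ 0`, `a_1, …, a_4 > 0`) and `F = threePointF 9 K R d g` in factored form
with `d_{k,r} ≥ 0` (so `Σ_{x,y,z} F ≥ 0` is automatic, `tripleSum_threePointF_nonneg`), subject to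
(i), (ii) with `B = 0`, value exactly `99`, and the zero-set condition on the slack of (i).  What
a kernel-checked instance must still supply are exactly the four polynomial facts `h1`, `h2`,
`hval`, `hzero` for the explicit rational data. -/
theorem card_le_98_of_certificate_data (C : Finset (EuclideanSpace ℝ (Fin 9)))
    (hC : ∀ x ∈ C, ‖x‖ = 1) (hcode : ∀ x ∈ C, ∀ y ∈ C, x ≠ y → inner ℝ x y ≤ 1 / 3)
    (deg : ℕ) (hdeg : 4 ≤ deg) (a : ℕ → ℝ) (ha : ∀ k, 0 ≤ a k)
    (ha1 : 0 < a 1) (ha2 : 0 < a 2) (ha3 : 0 < a 3) (ha4 : 0 < a 4)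
    (K R : ℕ) (d : ℕ → ℕ → ℝ) (hd : ∀ k r, 0 ≤ d k r) (g : ℕ → ℕ → ℝ → ℝ)
    (h1 : ∀ u : ℝ, -1 ≤ u → u ≤ 1 / 3 →
      (∑ k ∈ range (deg + 1), a k * gegenbauerSum (7 / 2) k u)
        + 3 * threePointF 9 K R d g u u 1 ≤ -1)
    (h2 : ∀ u v t : ℝ, -1 ≤ u → u ≤ 1 / 3 → -1 ≤ v → v ≤ 1 / 3 → -1 ≤ t → t ≤ 1 / 3 →
      0 ≤ 1 + 2 * u * v * t - u ^ 2 - v ^ 2 - t ^ 2 → threePointF 9 K R d g u v t ≤ 0)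
    (hval : 1 + (∑ k ∈ range (deg + 1), a k * gegenbauerSum (7 / 2) k 1)
      + threePointF 9 K R d g 1 1 1 = 99)
    (hzero : ∀ u : ℝ, -1 ≤ u → u ≤ 1 / 3 →
      (∑ k ∈ range (deg + 1), a k * gegenbauerSum (7 / 2) k u)
        + 3 * threePointF 9 K R d g u u 1 = -1 → u = 1 / 3 ∨ u = 0 ∨ u = -1 / 3 ∨ u = -1) :
    C.card ≤ 98 :=
  card_le_98_of_exact99_certificate C hC hcode deg hdeg a ha ha1 ha2 ha3 ha4
    (fun u => ∑ k ∈ range (deg + 1), a k * gegenbauerSum (7 / 2) k u) (fun _ => rfl)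
    (threePointF 9 K R d g) (tripleSum_threePointF_nonneg (by norm_num) K R d hd g C hC)
    (fun u v t => threePointF_swap12 9 K R d g u v t)
    (fun u v t => threePointF_swap23 9 K R d g u v t) h1 h2 hval hzero

end Summit.Ventures.PackingBounds.SphericalCodes
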